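import Mathlib.NumberTheory.ModularForms.CongruenceSubgroups
import Mathlib.Analysis.Normed.Group.Ultra
import Mathlib.Analysis.Normed.Field.Basic
import Mathlib.NumberTheory.Padics.Complex
import HarnessLib

/-!
# Crux `ThetaLayerLambdaCongruenceAtTwo` (stmt-BirchSwinnertonDyer-20688, route ResidualThetaTransportAtTwo), line
# `birth`, stub (C3) `stub_plusLineAtTwo` — ITEM A, part 2: T₂-EXCLUSION of boundary symbols at odd level (lead
# prover bsd-wall-rtt-p3 g3; `--supports stmt-BirchSwinnertonDyer-20688 --as helper`; closes nothing)

HONEST FRAMING. Elementary THEOREMS about functions `Φ : ℚ → R` only; nothing about any curve or form is asserted;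
BSD is not proved by any of this. This is piece (P3, cusp half) of the formalisation plan
`Cruxes/ThetaLayerLambdaCongruenceAtTwo/Lines/birth-C3-plan.md` for the plus-line stub (C3) of line `birth`
(«plus multiplicity one mod 2 for depleted Γ₀(N')-symbol functions», skeleton v7); companion file
`…ThetaLayerLambdaCongruenceAtTwoPeriodHom` (the period homomorphism `γ ↦ Φ(γ·∞)`).

WHAT (all hypotheses inline, in the binder shapes of (C3); `T₂Φ(x) = Σ_{j<2} Φ((x+j)/2) + Φ(2x)`):
* §1 two EXPLICIT elements of `Γ₀(N)`, `N` odd: `u/(2v) ↦ 2u/v` (`u`, `v` odd) and `a/(4b) ↦ (a+2b)/(4b)` (`a` odd).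
  Hence of the three `T₂`-translates `x/2, (x+1)/2, 2x` of a rational point two are always `Γ₀(N)`-equivalent and
  the third runs over all of `ℚ`: on `ℤ[cusps of Γ₀(N)]`, `N` odd, `T₂` is congruent modulo `2` to a PERMUTATION
  (the cusp `(c, a mod gcd(c, N/c))` goes to `(c, a/2)`), hence invertible mod `2`.
* §2 T₂-EXCLUSION, structural form (`mem_of_gamma0_invariant_of_heckeTwo`): if `Φ` is `Γ₀(N)`-invariant modulo a
  subgroup `S ≤ R`, `T₂Φ ∈ S` and `2Φ ∈ S` pointwise, then `Φ ∈ S` pointwise.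
* §3 corollaries: exact form `eq_zero_of_gamma0_invariant_of_heckeTwo` (`2R = 0`, e.g. `R = 𝔽̄₂`: no nonzero
  boundary = Eisenstein Manin function is killed by `T₂`); ultrametric form `norm_lt_one_of_gamma0_invariant_of_heckeTwo`
  (`‖2‖ < 1`); and the form consumed by (C3), `norm_lt_one_of_manin_of_norm_maninCusp_lt` /
  `exists_norm_maninCusp_eq_one_of_primitive`: an INTEGRAL Γ₀(N')-symbol function `Φ : ℚ → ℚ̄₂` that is `T₂`-eigen
  modulo the maximal ideal with a NON-UNIT eigenvalue (`a₂(W)` for `W` supersingular at `2`) and all of whose cusp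
  values `Φ(γ·∞)` lie in the maximal ideal, lies in the maximal ideal pointwise — so a PRIMITIVE one has a UNIT cusp
  value: the `𝔪`-eigen symbol functions of (C3) INJECT, modulo `𝔪`, into period homomorphisms `Γ₀(N') → k̄`; no
  boundary (Eisenstein) eigen-symbol survives `T₂ ∈ 𝔪`. This is where the hypothesis «`q = 2 ∤ N'` with eigenvalue
  `a₂(W) ≡ 0`» of (C3) is load-bearing.
NOT here: the elliptic half of (P3) (order-`2` elliptic elements), multiplicity one itself.

References: [Manin1972] §1.5–1.7; [CremonaAlgorithms1997] §2.2 (cusp equivalence in `Γ₀(N)`); [Merel1994] §1.2–1.3,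
§2 (Hecke operators on `ℤ[P¹(ℚ)]` and Manin symbols); [DiamondShurman2005] §3.8, §5.2.
-/

noncomputable section

-- justification: the `Summit.BirchSwinnertonDyer.BirchSwinnertonDyer.…` path repeats a component (route-file convention)
set_option linter.dupNamespace false

open scoped Classical MatrixGroups

open CongruenceSubgroup

namespace Summit.BirchSwinnertonDyer.BirchSwinnertonDyer.Theorems.ThetaLayerLambdaCongruenceAtTwo

/-! ## §1. Two explicit elements of `Γ₀(N)`, `N` odd, identifying two of the three `T₂`-translates of a cusp -/

section Matrices

variable {N : ℕ}

/-- For odd `N`, `u`, `v` (`v ≠ 0`): the element `γ = (2 + 2Nuv, −Nu²; Nv², (1 − Nuv)/2) ∈ Γ₀(N)` maps the point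
`u/(2v)` to `2u/v` (both lie in the cusp class `(gcd(v,N), 2·u·v/gcd)` of `Γ₀(N)`). [folklore] -/
theorem exists_gamma0_moebius_half_eq_double (hN : Odd N) (u v : ℤ) (hu : Odd u) (hv : Odd v) (hv0 : v ≠ 0) :
    ∃ γ : Gamma0 N, ((γ : SL(2, ℤ)) 1 0 : ℚ) * ((u : ℚ) / (2 * v)) + ((γ : SL(2, ℤ)) 1 1 : ℚ) ≠ 0 ∧
      ((((γ : SL(2, ℤ)) 0 0 : ℚ) * ((u : ℚ) / (2 * v)) + ((γ : SL(2, ℤ)) 0 1 : ℚ)) /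
        (((γ : SL(2, ℤ)) 1 0 : ℚ) * ((u : ℚ) / (2 * v)) + ((γ : SL(2, ℤ)) 1 1 : ℚ))) = 2 * u / v := by
  obtain ⟨k, hk⟩ : Odd (u * v * (N : ℤ)) := (hu.mul hv).mul hN.natCast
  let M : SL(2, ℤ) := ⟨!![2 + 2 * ((N : ℤ) * u * v), -((N : ℤ) * u ^ 2); (N : ℤ) * v ^ 2, -k], by
    rw [Matrix.det_fin_two_of]
    linear_combination (u * v * (N : ℤ) + 1) * hk⟩
  have hM : M ∈ Gamma0 N := by
    rw [Gamma0_mem]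
    show ((((N : ℤ) * v ^ 2 : ℤ)) : ZMod N) = 0
    push_cast
    simp
  refine ⟨⟨M, hM⟩, ?_, ?_⟩
  · show (((N : ℤ) * v ^ 2 : ℤ) : ℚ) * ((u : ℚ) / (2 * v)) + ((-k : ℤ) : ℚ) ≠ 0
    have hk' : (u : ℚ) * v * N = 2 * k + 1 := by exact_mod_cast hk
    have hv' : (v : ℚ) ≠ 0 := by exact_mod_cast hv0
    have e : (((N : ℤ) * v ^ 2 : ℤ) : ℚ) * ((u : ℚ) / (2 * v)) + ((-k : ℤ) : ℚ) = 1 / 2 := by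
      push_cast
      field_simp
      linear_combination hk'
    rw [e]; norm_num
  · show ((((2 + 2 * ((N : ℤ) * u * v) : ℤ)) : ℚ) * ((u : ℚ) / (2 * v)) + ((-((N : ℤ) * u ^ 2) : ℤ) : ℚ)) /
        ((((N : ℤ) * v ^ 2 : ℤ) : ℚ) * ((u : ℚ) / (2 * v)) + ((-k : ℤ) : ℚ)) = 2 * u / v
    have hk' : (u : ℚ) * v * N = 2 * k + 1 := by exact_mod_cast hk
    have hv' : (v : ℚ) ≠ 0 := by exact_mod_cast hv0
    have e : (((N : ℤ) * v ^ 2 : ℤ) : ℚ) * ((u : ℚ) / (2 * v)) + ((-k : ℤ) : ℚ) = 1 / 2 := by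
      push_cast
      field_simp
      linear_combination hk'
    rw [e]
    push_cast
    field_simp
    ring

/-- For odd `N` and `a` (`b ≠ 0`): the element `γ = (1 + 2bN(a+2b), (aN(a+2b) − 1)/… ; 8b²N, 1 − 2abN) ∈ Γ₀(N)`
(precisely `(1 + 2bN(a+2b), −m; 8b²N, 1 − 2abN)` with `aN(a+2b) = 2m+1`) maps `a/(4b)` to `(a+2b)/(4b)` (both lie in
the cusp class `(gcd(4b,N), 4ab/gcd)` of `Γ₀(N)`). [folklore] -/
theorem exists_gamma0_moebius_quarter_eq_quarter_add_half (hN : Odd N) (a b : ℤ) (ha : Odd a) (hb0 : b ≠ 0) :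
    ∃ γ : Gamma0 N, ((γ : SL(2, ℤ)) 1 0 : ℚ) * ((a : ℚ) / (4 * b)) + ((γ : SL(2, ℤ)) 1 1 : ℚ) ≠ 0 ∧
      ((((γ : SL(2, ℤ)) 0 0 : ℚ) * ((a : ℚ) / (4 * b)) + ((γ : SL(2, ℤ)) 0 1 : ℚ)) /
        (((γ : SL(2, ℤ)) 1 0 : ℚ) * ((a : ℚ) / (4 * b)) + ((γ : SL(2, ℤ)) 1 1 : ℚ))) = (a + 2 * b) / (4 * b) := by
  have hab : Odd (a + 2 * b) := by
    rcases ha with ⟨t, ht⟩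
    exact ⟨t + b, by rw [ht]; ring⟩
  obtain ⟨m, hm⟩ : Odd (a * (N : ℤ) * (a + 2 * b)) := (ha.mul hN.natCast).mul hab
  let M : SL(2, ℤ) := ⟨!![1 + 2 * b * ((N : ℤ) * (a + 2 * b)), -m; 8 * b ^ 2 * (N : ℤ), 1 - 2 * a * b * (N : ℤ)], by
    rw [Matrix.det_fin_two_of]
    linear_combination (-4 * b ^ 2 * (N : ℤ)) * hm⟩
  have hM : M ∈ Gamma0 N := by
    rw [Gamma0_mem]
    show (((8 * b ^ 2 * (N : ℤ) : ℤ)) : ZMod N) = 0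
    push_cast
    simp
  refine ⟨⟨M, hM⟩, ?_, ?_⟩
  · show (((8 * b ^ 2 * (N : ℤ) : ℤ)) : ℚ) * ((a : ℚ) / (4 * b)) + ((1 - 2 * a * b * (N : ℤ) : ℤ) : ℚ) ≠ 0
    have hb' : (b : ℚ) ≠ 0 := by exact_mod_cast hb0
    have e : (((8 * b ^ 2 * (N : ℤ) : ℤ)) : ℚ) * ((a : ℚ) / (4 * b)) + ((1 - 2 * a * b * (N : ℤ) : ℤ) : ℚ) = 1 := by
      push_cast
      field_simp
      ring
    rw [e]; norm_num
  · show ((((1 + 2 * b * ((N : ℤ) * (a + 2 * b)) : ℤ)) : ℚ) * ((a : ℚ) / (4 * b)) + ((-m : ℤ) : ℚ)) /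
        ((((8 * b ^ 2 * (N : ℤ) : ℤ)) : ℚ) * ((a : ℚ) / (4 * b)) + ((1 - 2 * a * b * (N : ℤ) : ℤ) : ℚ)) =
        (a + 2 * b) / (4 * b)
    have hm' : (a : ℚ) * N * (a + 2 * b) = 2 * m + 1 := by exact_mod_cast hm
    have hb' : (b : ℚ) ≠ 0 := by exact_mod_cast hb0
    have e : (((8 * b ^ 2 * (N : ℤ) : ℤ)) : ℚ) * ((a : ℚ) / (4 * b)) + ((1 - 2 * a * b * (N : ℤ) : ℤ) : ℚ) = 1 := by
      push_cast
      field_simp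
      ring
    rw [e, div_one]
    push_cast
    field_simp
    linear_combination (2 * b) * hm'

end Matrices

/-! ## §2. T₂-exclusion for boundary symbol functions at odd level -/

section TwoExclusion

variable {R : Type*} [AddCommGroup R] {N : ℕ}

/-- **T₂-EXCLUSION (structural form).** Let `N` be odd, `Φ : ℚ → R` a function that is `Γ₀(N)`-INVARIANT modulo an
additive subgroup `S` (`Φ(γ·r) − Φ(r) ∈ S`; e.g. a boundary symbol function, `S = 0`, or an `𝔪`-eigen Manin function
all of whose cusp values lie in `S = 𝔪`), killed by `T₂` modulo `S` (`Φ(x/2) + Φ((x+1)/2) + Φ(2x) ∈ S`) and with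
`2Φ ∈ S`. Then `Φ ∈ S` pointwise. Proof: for `r = a/b` in lowest terms, if `b` is odd the three `T₂`-translates of
`x = 2r − 1` are `u/(2v)`, `r`, `2u/v` (`u = 2a − b`, `v = b`) and the outer two are `Γ₀(N)`-equivalent
(`exists_gamma0_moebius_half_eq_double`); if `b` is even (so `a` is odd) the translates of `x = r/2` are `a/(4b)`,
`(a+2b)/(4b)`, `r` and the first two are `Γ₀(N)`-equivalent (`exists_gamma0_moebius_quarter_eq_quarter_add_half`);
either way `Φ(r) ≡ T₂Φ(x) − 2Φ(·) (mod S)`. (On `ℤ[cusps of Γ₀(N)]`, `N` odd, `T₂` is a permutation modulo `2`.)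
[folklore] -/
theorem mem_of_gamma0_invariant_of_heckeTwo (hN : Odd N) (Φ : ℚ → R) (S : AddSubgroup R)
    (hinv : ∀ (γ : Gamma0 N) (r : ℚ), ((γ : SL(2, ℤ)) 1 0 : ℚ) * r + ((γ : SL(2, ℤ)) 1 1 : ℚ) ≠ 0 →
      Φ ((((γ : SL(2, ℤ)) 0 0 : ℚ) * r + ((γ : SL(2, ℤ)) 0 1 : ℚ)) /
        (((γ : SL(2, ℤ)) 1 0 : ℚ) * r + ((γ : SL(2, ℤ)) 1 1 : ℚ))) - Φ r ∈ S)
    (hT : ∀ x : ℚ, (∑ j : Fin 2, Φ ((x + j) / 2)) + Φ (2 * x) ∈ S)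
    (h2 : ∀ y : ℚ, 2 • Φ y ∈ S) :
    ∀ r : ℚ, Φ r ∈ S := by
  intro r
  have hT' : ∀ x : ℚ, Φ (x / 2) + Φ ((x + 1) / 2) + Φ (2 * x) ∈ S := by
    intro x
    have h := hT x
    simpa only [Fin.sum_univ_two, Fin.val_zero, Nat.cast_zero, add_zero, Fin.val_one, Nat.cast_one] using h
  have hr : (r.num : ℚ) / (r.den : ℚ) = r := Rat.num_div_den r
  have hden : (r.den : ℚ) ≠ 0 := by exact_mod_cast r.den_nz
  rcases Nat.even_or_odd r.den with hev | hodd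
  · -- `b` even, hence `a` odd
    have hnum : Odd r.num := by
      rcases Int.even_or_odd r.num with h | h
      · exfalso
        have h2num : 2 ∣ r.num.natAbs := by
          rw [← even_iff_two_dvd, Int.natAbs_even]; exact h
        have h2den : 2 ∣ r.den := even_iff_two_dvd.mp hev
        have h := Nat.dvd_gcd h2num h2den
        rw [Nat.Coprime.gcd_eq_one r.reduced] at h
        exact absurd (Nat.le_of_dvd one_pos h) (by norm_num)
      · exact h
    have hb0 : (r.den : ℤ) ≠ 0 := by exact_mod_cast r.den_nz
    obtain ⟨γ, hγ0, hγ⟩ := exists_gamma0_moebius_quarter_eq_quarter_add_half hN r.num (r.den : ℤ) hnum hb0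
    have key := hinv γ ((r.num : ℚ) / (4 * (r.den : ℤ))) hγ0
    rw [hγ] at key
    have hx := hT' (r / 2)
    have e1 : (r / 2 / 2 : ℚ) = (r.num : ℚ) / (4 * ((r.den : ℤ) : ℚ)) := by
      conv_lhs => rw [← hr]
      push_cast; field_simp; ring
    have e2 : ((r / 2 + 1) / 2 : ℚ) = ((r.num : ℚ) + 2 * ((r.den : ℤ) : ℚ)) / (4 * ((r.den : ℤ) : ℚ)) := by
      conv_lhs => rw [← hr]
      push_cast; field_simp; ring
    have e3 : (2 * (r / 2) : ℚ) = r := by ring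
    rw [e1, e2, e3] at hx
    have e : Φ r = (Φ ((r.num : ℚ) / (4 * ((r.den : ℤ) : ℚ))) +
        Φ (((r.num : ℚ) + 2 * ((r.den : ℤ) : ℚ)) / (4 * ((r.den : ℤ) : ℚ))) + Φ r) -
        (Φ (((r.num : ℚ) + 2 * ((r.den : ℤ) : ℚ)) / (4 * ((r.den : ℤ) : ℚ))) -
          Φ ((r.num : ℚ) / (4 * ((r.den : ℤ) : ℚ)))) -
        2 • Φ ((r.num : ℚ) / (4 * ((r.den : ℤ) : ℚ))) := by
      rw [two_nsmul]; abel
    rw [e]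
    exact S.sub_mem (S.sub_mem hx key) (h2 _)
  · -- `b` odd
    obtain ⟨m, hm⟩ := hodd
    have hv : Odd (r.den : ℤ) := ⟨m, by exact_mod_cast hm⟩
    have hu : Odd (2 * r.num - (r.den : ℤ)) := ⟨r.num - m - 1, by push_cast [hm]; ring⟩
    have hv0 : (r.den : ℤ) ≠ 0 := by exact_mod_cast r.den_nz
    obtain ⟨γ, hγ0, hγ⟩ := exists_gamma0_moebius_half_eq_double hN (2 * r.num - (r.den : ℤ)) (r.den : ℤ) hu hv hv0
    have key := hinv γ (((2 * r.num - (r.den : ℤ) : ℤ) : ℚ) / (2 * ((r.den : ℤ) : ℚ))) hγ0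
    rw [hγ] at key
    have hx := hT' (2 * r - 1)
    have e1 : ((2 * r - 1) / 2 : ℚ) = ((2 * r.num - (r.den : ℤ) : ℤ) : ℚ) / (2 * ((r.den : ℤ) : ℚ)) := by
      conv_lhs => rw [← hr]
      push_cast; field_simp
    have e2 : ((2 * r - 1 + 1) / 2 : ℚ) = r := by ring
    have e3 : (2 * (2 * r - 1) : ℚ) = 2 * ((2 * r.num - (r.den : ℤ) : ℤ) : ℚ) / ((r.den : ℤ) : ℚ) := by
      conv_lhs => rw [← hr]
      push_cast; field_simp
    rw [e1, e2, e3] at hx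
    have e : Φ r = (Φ (((2 * r.num - (r.den : ℤ) : ℤ) : ℚ) / (2 * ((r.den : ℤ) : ℚ))) + Φ r +
        Φ (2 * ((2 * r.num - (r.den : ℤ) : ℤ) : ℚ) / ((r.den : ℤ) : ℚ))) -
        (Φ (2 * ((2 * r.num - (r.den : ℤ) : ℤ) : ℚ) / ((r.den : ℤ) : ℚ)) -
          Φ (((2 * r.num - (r.den : ℤ) : ℤ) : ℚ) / (2 * ((r.den : ℤ) : ℚ)))) -
        2 • Φ (((2 * r.num - (r.den : ℤ) : ℤ) : ℚ) / (2 * ((r.den : ℤ) : ℚ))) := by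
      rw [two_nsmul]; abel
    rw [e]
    exact S.sub_mem (S.sub_mem hx key) (h2 _)

end TwoExclusion

/-! ## §3. Corollaries: exact form (`2R = 0`) and ultrametric form (`‖2‖ < 1`, e.g. `ℚ̄₂`) -/

section Corollaries

variable {N : ℕ}

/-- **T₂-exclusion, exact form.** Over an additive group in which `2Φ = 0` (e.g. `Φ` valued in a field of
characteristic `2`): a `Γ₀(N)`-invariant function (`N` odd) killed by `T₂` vanishes identically — there is no nonzero
boundary (Eisenstein) Manin function over `𝔽̄₂` with `T₂ = 0` at odd level. [folklore] -/
theorem eq_zero_of_gamma0_invariant_of_heckeTwo {R : Type*} [AddCommGroup R] (hN : Odd N) (Φ : ℚ → R)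
    (h2 : ∀ y : ℚ, 2 • Φ y = 0)
    (hinv : ∀ (γ : Gamma0 N) (r : ℚ), ((γ : SL(2, ℤ)) 1 0 : ℚ) * r + ((γ : SL(2, ℤ)) 1 1 : ℚ) ≠ 0 →
      Φ ((((γ : SL(2, ℤ)) 0 0 : ℚ) * r + ((γ : SL(2, ℤ)) 0 1 : ℚ)) /
        (((γ : SL(2, ℤ)) 1 0 : ℚ) * r + ((γ : SL(2, ℤ)) 1 1 : ℚ))) = Φ r)
    (hT : ∀ x : ℚ, (∑ j : Fin 2, Φ ((x + j) / 2)) + Φ (2 * x) = 0) :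
    ∀ r : ℚ, Φ r = 0 := by
  have h := mem_of_gamma0_invariant_of_heckeTwo hN Φ (⊥ : AddSubgroup R)
    (fun γ r hr ↦ by rw [hinv γ r hr, sub_self]; exact (⊥ : AddSubgroup R).zero_mem)
    (fun x ↦ by rw [hT x]; exact (⊥ : AddSubgroup R).zero_mem)
    (fun y ↦ by rw [h2 y]; exact (⊥ : AddSubgroup R).zero_mem)
  intro r
  exact AddSubgroup.mem_bot.mp (h r)

variable {K : Type*} [NormedRing K] [IsUltrametricDist K]

/-- **T₂-exclusion modulo the maximal ideal.** Over an ultrametric normed ring with `‖2‖ < 1`: a function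
`Φ : ℚ → K` with `‖Φ‖ ≤ 1` that is `Γ₀(N)`-invariant modulo the open unit ball (`N` odd) and `T₂`-eigen modulo the
open unit ball with a NON-UNIT eigenvalue `a` (`‖T₂Φ − aΦ‖ < 1`, `‖a‖ < 1`) satisfies `‖Φ‖ < 1` pointwise.
[folklore] -/
theorem norm_lt_one_of_gamma0_invariant_of_heckeTwo (hK : ‖(2 : K)‖ < 1) (hN : Odd N) (Φ : ℚ → K) (a : K)
    (ha : ‖a‖ < 1) (hle : ∀ r : ℚ, ‖Φ r‖ ≤ 1)
    (hinv : ∀ (γ : Gamma0 N) (r : ℚ), ((γ : SL(2, ℤ)) 1 0 : ℚ) * r + ((γ : SL(2, ℤ)) 1 1 : ℚ) ≠ 0 →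
      ‖Φ ((((γ : SL(2, ℤ)) 0 0 : ℚ) * r + ((γ : SL(2, ℤ)) 0 1 : ℚ)) /
        (((γ : SL(2, ℤ)) 1 0 : ℚ) * r + ((γ : SL(2, ℤ)) 1 1 : ℚ))) - Φ r‖ < 1)
    (hT : ∀ x : ℚ, ‖(∑ j : Fin 2, Φ ((x + j) / 2)) + Φ (2 * x) - a * Φ x‖ < 1) :
    ∀ r : ℚ, ‖Φ r‖ < 1 := by
  let S : AddSubgroup K :=
    { carrier := {z | ‖z‖ < 1}
      add_mem' := fun {x y} hx hy ↦ (IsUltrametricDist.norm_add_le_max x y).trans_lt (max_lt hx hy)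
      zero_mem' := by simp
      neg_mem' := fun {x} hx ↦ by simpa using hx }
  have hS : ∀ z : K, z ∈ S ↔ ‖z‖ < 1 := fun z ↦ Iff.rfl
  have h := mem_of_gamma0_invariant_of_heckeTwo hN Φ S (fun γ r hr ↦ (hS _).mpr (hinv γ r hr))
    (fun x ↦ by
      have e : (∑ j : Fin 2, Φ ((x + j) / 2)) + Φ (2 * x) =
          ((∑ j : Fin 2, Φ ((x + j) / 2)) + Φ (2 * x) - a * Φ x) + a * Φ x := (sub_add_cancel _ _).symm
      rw [e]
      exact S.add_mem ((hS _).mpr (hT x))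
        ((hS _).mpr ((norm_mul_le _ _).trans_lt (mul_lt_one_of_nonneg_of_lt_one_left (norm_nonneg a) ha (hle x)))))
    (fun y ↦ (hS _).mpr (by
      rw [nsmul_eq_mul, Nat.cast_ofNat]
      exact (norm_mul_le _ _).trans_lt (mul_lt_one_of_nonneg_of_lt_one_left (norm_nonneg _) hK (hle y))))
  intro r
  exact (hS _).mp (h r)

/-- **Injectivity of the period map on `𝔪`-eigen symbol functions, modulo `𝔪`** — the form used for (C3): let `N`
be odd and `Φ : ℚ → K` an INTEGRAL Γ₀(N)-symbol function (Manin's relation) that is `T₂`-eigen modulo the maximal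
ideal with a non-unit eigenvalue (`‖T₂Φ − aΦ‖ < 1`, `‖a‖ < 1` — for (C3): `a = a₂(W)`, even for `W` supersingular at
`2`). If ALL CUSP VALUES `Φ(γ·∞)`, `γ ∈ Γ₀(N)`, lie in the maximal ideal (the period homomorphism of `Φ` vanishes
mod `𝔪`), then `Φ` itself lies in the maximal ideal pointwise. Equivalently: a primitive such `Φ` has a unit cusp
value — its reduction mod `𝔪` is NOT a boundary symbol. [folklore] -/
theorem norm_lt_one_of_manin_of_norm_maninCusp_lt (hK : ‖(2 : K)‖ < 1) (hN : Odd N) (Φ : ℚ → K) (a : K)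
    (ha : ‖a‖ < 1)
    (hM : ∀ (γ : Gamma0 N) (r : ℚ), ((γ : SL(2, ℤ)) 1 0 : ℚ) * r + ((γ : SL(2, ℤ)) 1 1 : ℚ) ≠ 0 →
      Φ ((((γ : SL(2, ℤ)) 0 0 : ℚ) * r + ((γ : SL(2, ℤ)) 0 1 : ℚ)) /
        (((γ : SL(2, ℤ)) 1 0 : ℚ) * r + ((γ : SL(2, ℤ)) 1 1 : ℚ))) =
        (if ((γ : SL(2, ℤ)) 1 0) = 0 then 0 else Φ ((((γ : SL(2, ℤ)) 0 0 : ℚ)) / (((γ : SL(2, ℤ)) 1 0 : ℚ)))) + Φ r)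
    (hle : ∀ r : ℚ, ‖Φ r‖ ≤ 1)
    (hcusp : ∀ γ : Gamma0 N, (γ : SL(2, ℤ)) 1 0 ≠ 0 →
      ‖Φ ((((γ : SL(2, ℤ)) 0 0 : ℚ)) / (((γ : SL(2, ℤ)) 1 0 : ℚ)))‖ < 1)
    (hT : ∀ x : ℚ, ‖(∑ j : Fin 2, Φ ((x + j) / 2)) + Φ (2 * x) - a * Φ x‖ < 1) :
    ∀ r : ℚ, ‖Φ r‖ < 1 := by
  refine norm_lt_one_of_gamma0_invariant_of_heckeTwo hK hN Φ a ha hle (fun γ r hr ↦ ?_) hT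
  rw [hM γ r hr, add_sub_cancel_right]
  by_cases hc : (γ : SL(2, ℤ)) 1 0 = 0
  · rw [if_pos hc, norm_zero]; exact one_pos
  · rw [if_neg hc]; exact hcusp γ hc

/-- `‖2‖ = 1/2 < 1` in `ℚ̄₂` (the tree's `norm_two_padicAlgCl_lt_one` lives in a heavier module; re-derived here to
keep this file's imports minimal). [folklore] -/
private theorem norm_two_lt_one_padicAlgCl_two : ‖(2 : PadicAlgCl 2)‖ < 1 := by
  have h : ‖(2 : PadicAlgCl 2)‖ = (2 : ℝ)⁻¹ := by
    rw [show (2 : PadicAlgCl 2) = ((2 : ℕ) : PadicAlgCl 2) by norm_num,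
      ← map_natCast (algebraMap ℚ_[2] (PadicAlgCl 2)) 2]
    change ‖(((2 : ℕ) : ℚ_[2]) : PadicAlgCl 2)‖ = (2 : ℝ)⁻¹
    rw [PadicAlgCl.norm_extends, Padic.norm_p]
    norm_num
  rw [h]; norm_num

/-- **The `ℚ̄₂` instance used by (C3)**: an integral Γ₀(N')-symbol function `Φ : ℚ → ℚ̄₂` (`N'` odd) that is
`T₂`-eigen modulo the maximal ideal of `ℚ̄₂` with a non-unit eigenvalue and whose cusp values all lie in the
maximal ideal, lies in the maximal ideal pointwise; contrapositively a PRIMITIVE such `Φ` (some `‖Φ r‖ = 1`, as in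
(C3)) has a unit cusp value `‖Φ(γ·∞)‖ = 1` for some `γ ∈ Γ₀(N')`. [folklore] -/
theorem exists_norm_maninCusp_eq_one_of_primitive (hN : Odd N) (Φ : ℚ → PadicAlgCl 2) (a : PadicAlgCl 2)
    (ha : ‖a‖ < 1)
    (hM : ∀ (γ : Gamma0 N) (r : ℚ), ((γ : SL(2, ℤ)) 1 0 : ℚ) * r + ((γ : SL(2, ℤ)) 1 1 : ℚ) ≠ 0 →
      Φ ((((γ : SL(2, ℤ)) 0 0 : ℚ) * r + ((γ : SL(2, ℤ)) 0 1 : ℚ)) /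
        (((γ : SL(2, ℤ)) 1 0 : ℚ) * r + ((γ : SL(2, ℤ)) 1 1 : ℚ))) =
        (if ((γ : SL(2, ℤ)) 1 0) = 0 then 0 else Φ ((((γ : SL(2, ℤ)) 0 0 : ℚ)) / (((γ : SL(2, ℤ)) 1 0 : ℚ)))) + Φ r)
    (hle : ∀ r : ℚ, ‖Φ r‖ ≤ 1) (hprim : ∃ r : ℚ, ‖Φ r‖ = 1)
    (hT : ∀ x : ℚ, ‖(∑ j : Fin 2, Φ ((x + j) / 2)) + Φ (2 * x) - a * Φ x‖ < 1) :
    ∃ γ : Gamma0 N, (γ : SL(2, ℤ)) 1 0 ≠ 0 ∧ ‖Φ ((((γ : SL(2, ℤ)) 0 0 : ℚ)) / (((γ : SL(2, ℤ)) 1 0 : ℚ)))‖ = 1 := by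
  by_contra h
  simp only [not_exists, not_and] at h
  have hcusp : ∀ γ : Gamma0 N, (γ : SL(2, ℤ)) 1 0 ≠ 0 →
      ‖Φ ((((γ : SL(2, ℤ)) 0 0 : ℚ)) / (((γ : SL(2, ℤ)) 1 0 : ℚ)))‖ < 1 :=
    fun γ hc ↦ lt_of_le_of_ne (hle _) (h γ hc)
  obtain ⟨r, hr⟩ := hprim
  have := norm_lt_one_of_manin_of_norm_maninCusp_lt norm_two_lt_one_padicAlgCl_two hN Φ a ha hM hle hcusp hT r
  rw [hr] at this
  exact lt_irrefl _ this

end Corollaries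

end Summit.BirchSwinnertonDyer.BirchSwinnertonDyer.Theorems.ThetaLayerLambdaCongruenceAtTwo

end
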